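import Summits.AtomisticToContinuum.Crystallization.Theorems.ReggeStarCoercivityStabilityConstantTwelve
import Summits.AtomisticToContinuum.Crystallization.Theorems.ReggeStarCoercivityStabilityConstantTwelveNegWitnesses
import Summits.AtomisticToContinuum.Crystallization.Theorems.ReggeStarCoercivityStabilityConstantTwelveNegDFourBlock0
import Summits.AtomisticToContinuum.Crystallization.Theorems.ReggeStarCoercivityStabilityConstantTwelveNegDFourBlock1
import Summits.AtomisticToContinuum.Crystallization.Theorems.ReggeStarCoercivityStabilityConstantTwelveNegDFourBlock2
import Summits.AtomisticToContinuum.Crystallization.Theorems.ReggeStarCoercivityStabilityConstantTwelveNegDFourBlock3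
import Summits.AtomisticToContinuum.Crystallization.Theorems.ReggeStarCoercivityStabilityConstantTwelveNegDFourBlock4

/-!
# Route `ReggeStarCoercivity`, crux `StabilityConstantTwelve` (stmt-AtomisticToContinuum-13601) —
# negative side III: the `D₄` ball, and the dimension threshold is exactly `d = 3`

Supporting file for the CLOSED item stmt-AtomisticToContinuum-13601 (`stabilityConstantTwelve_proof`,
`E(N) ≥ -N` in `ℝ³`).  Port into `Theorems/` (LEAN-IN-TREE rule, 2026-08-18) of the disprover's crux
companion `Summits/AtomisticToContinuum/Crystallization/Cruxes/StabilityConstantTwelve/DisproofHeavyD4.lean`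
(namespace `….Cruxes.StabilityConstantTwelve.Disproof.HeavyD4`, 2026-08-16; same names, statements and
proofs verbatim, over the evaluation machine `Cert.*` of `…NegCert.lean` instead of a private copy; the
bundle's hand package carried the same text as `LJStability/NegativeD4.lean:37–103`), plus the threshold
corollaries, which before this file existed only in the bundle (`NegativeD4.lean:107`):

* `d4_energy_le : E_{ℝ⁴}(409) ≤ -420 < -409` — the `D₄` ball `{v ∈ ℤ⁴ : ∑ vᵢ even, |v|² ≤ 12}` (409
  points) at nearest-neighbour distance `√0.92` (exact energy `-426.457…`); the certificate is split into
  five row blocks (`Cert.hsumB`) of ≤ 60 s kernel time each (`decide +kernel`; no `native_decide`,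
  standard axioms; about four minutes in all), hence `not_stability_dim4`;
* `not_stability_dim_ge_four` — by zero-padding (`groundStateEnergy_mono_dim`) the `ℝᵈ` analogue fails
  for EVERY `d ≥ 4` (the docstrings of `Cruxes/…/Disproof.lean` §3 cite this corollary by name);
* `stability_of_dim_le_three`, `stability_iff_dim_le_three` — for `d ≥ 1`:
  `(∀ N, -N ≤ E_{ℝᵈ}(N)) ↔ d ≤ 3`.  THREE IS THE LAST DIMENSION in which the stability constant `12 ε`
  (one bond per particle) holds (lattice sums: `e(D₄) ≈ -2.15`, `e(fcc) = -0.7175`).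
-/

noncomputable section

namespace Summit.AtomisticToContinuum.Crystallization.Theorems.StabilityConstantTwelveNegative

open Literature.MathematicalPhysics.StatisticalMechanics
open Cert

/-- the five block bounds add up to `-842.89 ≤ 2 * (-420)` (exact `2 E = -852.91…`). [port of `…Cruxes.StabilityConstantTwelve.Disproof.HeavyD4.d4_hsum_le`] -/
theorem d4_hsum_le : hsum d4Rows (23 / 50) ≤ 2 * (-420) := by
  have h0 := d4_block0; have h1 := d4_block1; have h2 := d4_block2; have h3 := d4_block3
  have h4 := d4_block4
  rw [hsum_eq_hsumB, hsumB_split _ _ _ 82, hsumB_drop_split _ _ _ 82 82,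
    hsumB_drop_split _ _ _ (82 + 82) 82, hsumB_drop_split _ _ _ (82 + 82 + 82) 82]
  norm_num only
  norm_num only at h0 h1 h2 h3 h4
  linarith

set_option maxHeartbeats 40000000 in
/-- `d = 4`: `E(409) ≤ -420 < -409` (exact `-426.457…` at `s = 23/50`). [port of `…Cruxes.StabilityConstantTwelve.Disproof.HeavyD4.d4_energy_le`] -/
theorem d4_energy_le : groundStateEnergy lennardJones 4 409 ≤ -(420 : ℝ) := by
  have h := groundStateEnergy_le_of_cert (d := 4) (s := 23 / 50) (by norm_num) (L := d4Rows)
    (by decide +kernel) (by decide +kernel) (b := -420) d4_hsum_le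
  have hl : d4Rows.length = 409 := by decide +kernel
  rw [hl] at h
  exact h.trans (by norm_num)

/-- THE DIMENSION THRESHOLD IS `3 → 4`: the `ℝ⁴` analogue of `E(N) ≥ -N` is false.
[port of `…Cruxes.StabilityConstantTwelve.Disproof.HeavyD4.not_stability_dim4`] -/
theorem not_stability_dim4 : ¬ ∀ N : ℕ, -(N : ℝ) ≤ groundStateEnergy lennardJones 4 N := by
  intro h; have h1 := h 409; norm_num at h1; linarith [d4_energy_le]

/-- The `ℝᵈ` analogue of `StabilityConstantTwelve` fails for every `d ≥ 4`: zero-pad the 409-point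
`D₄`-ball configuration (`E_{ℝ⁴}(409) ≤ -420 < -409`) into `ℝᵈ` (`groundStateEnergy_mono_dim`).
Same three lines as `not_stability_dim_ge_five`. [folklore] -/
theorem not_stability_dim_ge_four {d : ℕ} (hd : 4 ≤ d) :
    ¬ ∀ N : ℕ, -(N : ℝ) ≤ groundStateEnergy lennardJones d N := by
  obtain ⟨k, rfl⟩ := Nat.exists_eq_add_of_le hd
  intro h
  have h1 := h 409
  have h2 := groundStateEnergy_mono_dim (d := 4) (by norm_num) k 409
  norm_num at h1
  linarith [d4_energy_le]

/-- For `1 ≤ d ≤ 3` the analogue holds: `-N ≤ E_{ℝ³}(N) ≤ E_{ℝᵈ}(N)` (`stabilityConstantTwelve_proof`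
and zero-padding `ℝᵈ ⊂ ℝ³`). [folklore] -/
theorem stability_of_dim_le_three {d : ℕ} (hd : 0 < d) (hd3 : d ≤ 3) (N : ℕ) :
    -(N : ℝ) ≤ groundStateEnergy lennardJones d N := by
  obtain ⟨k, hk⟩ : ∃ k, 3 = d + k := ⟨3 - d, by omega⟩
  have hmono := groundStateEnergy_mono_dim hd k N
  rw [← hk] at hmono
  have h3 : -(N : ℝ) ≤ groundStateEnergy lennardJones 3 N := stabilityConstantTwelve_proof N
  exact h3.trans hmono

/-- THE DIMENSION THRESHOLD IS EXACTLY THREE: for `d ≥ 1`, every configuration of `N` distinct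
Lennard-Jones particles in `ℝᵈ` has energy `≥ -N` for all `N` if and only if `d ≤ 3`
(`d ≤ 3`: `stabilityConstantTwelve_proof`, `B_LJ ≤ 12 ε`; `d ≥ 4`: `not_stability_dim_ge_four`).
(`d = 0` is excluded: `ℝ⁰` is a point, no injective configuration of `N ≥ 2` points exists and
`groundStateEnergy` takes the junk value `0` there.) [folklore] -/
theorem stability_iff_dim_le_three {d : ℕ} (hd : 0 < d) :
    (∀ N : ℕ, -(N : ℝ) ≤ groundStateEnergy lennardJones d N) ↔ d ≤ 3 := by
  constructor
  · intro h
    by_contra hlt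
    exact not_stability_dim_ge_four (by omega) h
  · intro hd3 N
    exact stability_of_dim_le_three hd hd3 N

end Summit.AtomisticToContinuum.Crystallization.Theorems.StabilityConstantTwelveNegative

end
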